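import Summits.BirchSwinnertonDyer.BirchSwinnertonDyer.Theorems.PrintCFramBottomClassIndexLawFiveLeGenusInternalShaInput
import Summits.BirchSwinnertonDyer.BirchSwinnertonDyer.Theorems.PrintCFramBottomClassIndexLawFiveLeGenusInternalShaTwist
import Summits.BirchSwinnertonDyer.BirchSwinnertonDyer.Theorems.PrintCFramBottomClassIndexLawFiveLeKrizLiLocusLValueFree
import Summits.BirchSwinnertonDyer.BirchSwinnertonDyer.Theorems.PrintCFramBottomClassIndexLawFiveLeKrizLiBindersTwist
import Summits.BirchSwinnertonDyer.BirchSwinnertonDyer.Theorems.PrintCFramBottomClassIndexLawFiveLeBernoulliKummerDictionary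
import Summits.BirchSwinnertonDyer.Rank1Residual.Partition.CornersCM
import Literature.NumberTheory.Automorphic.EichlerEmbeddingLocalLevel
import HarnessLib

/-!
# Route `PrintCFram`, crux C2 `BottomClassIndexLawFiveLe` (stmt-BirchSwinnertonDyer-20372), line `eisenstein-resource-bdp-line`:
# (GI-S) THE STRIPPED IDENTITY ROAD — the identity-road end state `BSD_p` of the rank-one twist from a Kriz–Li datum of a
# GENERAL base class member `V` over ANY imaginary quadratic Heegner field (u_K-free: `ℚ(√−3)`, `ℚ(i)` allowed)

Cell `bsd-print-cfram`, width seat `bsd-line-cfram-p1-w7` g8 (prover); helper `--supports` stmt-BirchSwinnertonDyer-20372; THEOREMS ONLY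
(0 definitions, 0 named facts, 0 `sorry`); nothing registered is touched. BSD is not proved by any of this; no summit statement is proved by
this seat; no registered stub is closed.

WHAT. The genus-internal branch of `stub_seedOffExc` (ideator bsd-idea-7 g19/g20, critic V#146) has two kernel providers of `BSDp W 7` for
the rank-one twists `W ≅ X₀(49)^{(d_K)}`: w7 g7's halves road `GenusInternal.bsdp_twist_of_strippedKrizLiDatum_of_prints` (general base `V`,
Hsieh ∧ LZZ ∧ toric ∧ Burungale–Flach, `d_K < −4`) and the identity road of w6 g8 / w3 g16 / w4 g19 (`…_of_sha_twist`, base `V = cm7` ONLY,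
any `d_K`). This file is the identity road with the BASE GENERALISED: `V/ℚ` any globally minimal CM curve with `CMRamified V p`, `p ≥ 5`,
over ANY imaginary quadratic `K` with the Heegner hypothesis for `N_V` — no parity, no `d_K < −4`, so the strippings `e* = D·f` of a
rank-one class `e*` with `D ∈ {−3, −4}` (ideator g20: «−39 = (−3)·13 by stripping, display variant owed»; w8 g9 (c); LEAD g14 06:58:09Z
«D ∣ e* ⟹ base A^{(e*/D)}») are served, which the halves road cannot reach (`d_K < −4` is LIVE there: Liu–Zhang–Zhang's display).

* §1 `bsdp_twist_of_krizLiOddDatum_identityRoad` — for `V` as above, a level-`N_V` parametrisation datum `Dt` with `p ∤ c(Dt)`, Heegner data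
  `(H, ι, P)`, `ιp : K → ℚ_p`, an ODD Kriz–Li datum `(f, ψ, ω)` at `V` (primitive, Teichmüller, trace form, (1), (3)), the Kronecker character
  `ε_K` and Thm. 1.20's hypothesis (4) VERBATIM: **`BSDp W p` for every globally minimal `W` with `C • W = V^{(d_K)}` of analytic rank one.**
  Facts by name: Kriz–Li Thm. 1.20, Gross–Zagier + Kolyvagin at `(N_V, V, K)`, GZK, modularity, Gross–Zagier I.(7.3), Cassels–Tate,
  Burungale–Flach Cor. 2 (`BSDp V p` in rank `0`). NO Hsieh / Liu–Zhang–Zhang / toric bundle. Chain: Thm. 1.20 at `(V, K, ιp)` ⟹ unit log ⟹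
  `P` non-torsion ⟹ `r_an(V) = 0` (Gross–Zagier: `L′(V/K,1) = L(V,1)·L′(W,1)`); (4) splits on the class into a unit class factor
  `B_{1,ψ⁻¹}` and a unit field factor (`BernoulliUnits.norm_bernoulliPair_le_one_of_hss`) ⟹ `Ш(V)[p] = 0` ((α′) + Cassels–Tate in rank 0) and
  `Ш(W)[p] = 0` (w4 g19 `sha_noPTorsion_twist_of_unit_fieldFactor_of_analyticRank_le_one`) ⟹ `ord_p #Ш(V/K) = 0`; `V(K)[p] = 0`
  (`RamifiedSevenEllipticUnits.prime_nsmul_eq_zero_padic_of_hasCM_of_cmRamified` along `ιp`), `p ∤ ∏c_ℓ(V)` (bsd-cm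
  `RouteU.not_dvd_tamagawaProduct_of_hasCM`) ⟹ `X11b.IndexIdentityAt V p K P` (w3 g16 `indexIdentityAt_of_not_le_inv_of_addv`) ⟹ `BSDp W p`
  (w3 g16 `bsdp_twist_of_indexIdentityAt_of_bsdp_rankZero`).
* §2 `bsdp_twist_of_classDatum_coregular_identityRoad` — the same in CLASS-DATUM currency: the datum of `V` is a class datum
  `(m, χ, ε, k)` (`KrizLiBinders.exists_krizLiData_of_cmRamified`: `χ` primitive quadratic mod `m ⊥ p`, `2 ≤ k ≤ p − 2`, `χ(−1)(−1)^k = −1`,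
  trace form `a_ℓ(V) ≡ ε(ℓ)(ℓ^k + ℓ^{p−k})`, `V` good off `p·m`), and (4) is replaced by the TWO numbers of registry v26's currency:
  V's own regularity `¬ ‖(p−k)⁻¹ B_{p−k,χ}‖ ≤ p⁻¹` («co-regularity» of the stripping, `KummerDictionary.norm_bernoulliOnePrim_psi_inv_le_inv_iff`)
  and the regularity of the rank-one class `¬ ‖k⁻¹ B_{k,(χ·ε_K)~}‖ ≤ p⁻¹` (`KummerDictionary.norm_bernoulliOnePrim_bernoulliCharTwo_le_inv_iff`).
  At `p = 7`, `V ∼ 49a1^{(f)}`, `K = ℚ(√D)`, `e* = D·f`: the pair is `reg(f)·reg(e*) = (B_{2,χ_f}/2)·(B_{5,χ_{e*}}/5)` (w8 g9 (c)); for the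
  window class `e* = −39 = (−3)·13`: `B_{2,χ₁₃}/2 = 2`, a `7`-unit, and `7`, `13` split in `ℚ(√−3)`.

HONEST FRAMING: Gross–Zagier bookkeeping over landed kernels; CONDITIONAL on the named facts displayed as hypotheses; beyond-print theorem:
NO. The per-class inputs left displayed are exactly those of the identity road at `cm7`: a level-`N_V` parametrisation datum with `p ∤ c`
(optimal-curve Manin certificate) and the Heegner field. References: [KrizLi2019] Thm. 1.20, Rem. 1.21, §2, §7.1; [GrossZagier1986] I.(6.3),
I.(7.3), V.§2; [CastellaGrossiLeeSkinner2022] (5.5)–(5.7); [Cassels1962ArithmeticIV]; [BurungaleFlach2024] Cor. 2; [Miller2011LMS] Def. 1.1;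
[Mazur1977] III.5; [Mazur1978] Prop. 6.3; [Washington1997] Thm. 5.11, Cor. 5.13; crux notes `Lines/eisenstein-resource-bdp-line-w3g16-notes.md`,
`…-w7g7-notes.md`, `…-w8g9` STATUS 06:50:20Z (c).
-/

set_option autoImplicit false
-- `…BirchSwinnertonDyer.BirchSwinnertonDyer.Theorems…` is the problem's mandated namespace (D-0017).
set_option linter.dupNamespace false

noncomputable section

open scoped Classical

open WeierstrassCurve NumberField DirichletCharacter
  Literature.NumberTheory.EllipticCurves
  Literature.NumberTheory.EllipticCurves.ModularForms
  Literature.NumberTheory.EllipticCurves.KrizLi2019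
  Literature.NumberTheory.LFunctions
  Literature.NumberTheory.EllipticCurves.Rank1Residual
  Literature.NumberTheory.EllipticCurves.Rank1Residual.Typed
  Summit.BirchSwinnertonDyer.Rank1Residual
  Summit.BirchSwinnertonDyer.Rank1Residual.X12.O11
  Summit.BirchSwinnertonDyer.BirchSwinnertonDyer.Theorems
  Summit.BirchSwinnertonDyer.BirchSwinnertonDyer.Theorems.PrintCFram

namespace Summit.BirchSwinnertonDyer.BirchSwinnertonDyer.Theorems.PrintCFram.GenusInternal

/-! ## §1. The identity-road end state for a GENERAL base class member `V`, any imaginary quadratic Heegner field -/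

/-- **(GI-S) `BSD_p` OF THE RANK-ONE TWIST BY THE IDENTITY ROAD, GENERAL BASE.** Let `V/ℚ` be globally minimal with CM, `CMRamified V p`,
`p ≥ 5`, of conductor `N`; `K` imaginary quadratic with the Heegner hypothesis for `N` (so `p ∣ N` splits; ANY `d_K`, `ℚ(√−3)` and `ℚ(i)`
included); `Dt` a level-`N` parametrisation datum with `p ∤ c(Dt)`, `H` a Heegner datum, `P ∈ V(K)` the Heegner point (`ι(P) = heegnerPointComplex Dt H`),
`ιp : K → ℚ_p`; `(f, ψ, ω)` an ODD Kriz–Li datum at `(V, p)` — `ψ` primitive and odd, `ω` Teichmüller, the trace form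
`‖a_ℓ(V) − (ψ(ℓ) + ψ⁻¹ω(ℓ))‖ < 1` off `p·N`, (1) at `p`, (3) at the additive `ℓ ≠ p` —, `ε_K` the Kronecker character and Thm. 1.20's (4)
`¬ ‖B_{1,ψ₀⁻¹ε_K}·B_{1,ψ₀ω⁻¹}‖ ≤ p⁻¹`. Then, granted Kriz–Li Thm. 1.20, Gross–Zagier and Kolyvagin at `(N, V, K)`, GZK, modularity,
Gross–Zagier I.(7.3), Cassels–Tate and Burungale–Flach Cor. 2: **`BSDp W p` for every globally minimal `W` with `C • W = V^{(d_K)}` and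
`ord_{s=1} L(W,s) = 1`.** Chain in the module docstring; no Hsieh / Liu–Zhang–Zhang / toric input, no parity or size condition on `d_K`.
CONDITIONAL on the named facts; closes no stub. [cite: KrizLi2019, Thm. 1.20 (pp. 7–8), Rem. 1.21 (p. 8), §7.1 (p. 43)]
[cite: GrossZagier1986, Thm. I.(6.3), I.(7.3) and V.§2 (pp. 310–312)] [cite: CastellaGrossiLeeSkinner2022, proof of Thm. 5.3.1, (5.5)–(5.7)]
[cite: Cassels1962ArithmeticIV] [cite: BurungaleFlach2024, Thm. 1.1 and Cor. 2] [cite: Miller2011LMS, Def. 1.1] [cite: Mazur1977, Ch. III §5 Step 1] -/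
theorem bsdp_twist_of_krizLiOddDatum_identityRoad {p : ℕ} [hp : Fact p.Prime]
    (hKL : thm120_padicLogHeegner_unit_of_bernoulli)
    (hCT : exists_casselsTate_pairing (K := ℚ)) (hGZK : rank_eq_analyticRank_of_analyticRank_le_one)
    (hmod : hasEntireLFunction_rat) (hGZ73 : GrossZagier1986_thm_I_7_3) (hBF : bsdTriple_of_hasCM_of_L_one_ne_zero)
    (V : WeierstrassCurve ℚ) [V.IsElliptic] [V.IsGloballyMinimal] (hCM : V.HasCM) (hram : CMRamified V p) (h5 : 5 ≤ p)
    {N : ℕ} [NeZero N] (hN : V.conductorNorm ℤ = N)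
    (K : Type) [Field K] [NumberField K] (hK : IsImaginaryQuadratic K) (hHN : SatisfiesHeegnerHypothesis N K)
    (hGZ : gross_zagier N V K) (hKo : kolyvagin N V K)
    (Dt : ModularParametrizationData V N) (H : HeegnerDatum N (NumberField.discr K)) (ι : K →+* ℂ) (ιp : K →+* ℚ_[p])
    (P : (V.baseChange K).toAffine.Point)
    (hP : WeierstrassCurve.Affine.Point.map ι.toRatAlgHom P = heegnerPointComplex Dt H)
    (hc : ¬ (p : ℤ) ∣ Dt.c)
    -- the odd Kriz–Li datum at `(V, p)`
    {f : ℕ} [NeZero f] (ψ : DirichletCharacter ℚ_[p] f) (ω : DirichletCharacter ℚ_[p] p)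
    (hψ : ψ.IsPrimitive) (hψodd : ψ.Odd) (hω : IsTeichmullerCharacter ω)
    (hss : ∀ ℓ : ℕ, ℓ.Prime → ¬ (ℓ ∣ p * V.conductorNorm ℤ) →
      ‖((V.LFunction ℓ : ℤ) : ℚ_[p]) - (ψ (ℓ : ZMod f) + ψ⁻¹ (ℓ : ZMod f) * ω (ℓ : ZMod p))‖ < 1)
    (h1 : ψ (p : ZMod f) ≠ 1) (h1' : primVal (invMulOmega ψ ω) p ≠ 1)
    (h3 : ∀ ℓ : ℕ, (hℓ : ℓ.Prime) → ℓ ≠ p →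
      (haveI := Fact.mk hℓ; ¬ V.HasGoodReductionAtPrime ℓ ∧ ¬ V.HasMultiplicativeReductionAtPrime ℓ) →
      ψ (ℓ : ZMod f) ≠ 1 ∧ primVal (invMulOmega ψ ω) ℓ ≠ 1)
    -- the Kronecker character and Thm. 1.20's hypothesis (4), verbatim
    (εK : DirichletCharacter ℚ_[p] (NumberField.discr K).natAbs) (hεK : IsKroneckerCharacterOf K εK)
    (h4 : ¬ ‖bernoulliOnePrim (bernoulliCharOne ψ εK) * bernoulliOnePrim (bernoulliCharTwo ψ εK ω)‖ ≤ (p : ℝ)⁻¹)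
    -- the rank-one twist
    (W : WeierstrassCurve ℚ) [W.IsElliptic] [W.IsGloballyMinimal]
    (hW : ∃ C : VariableChange ℚ, C • W = V.quadraticTwist (NumberField.discr K : ℚ)) (hr : W.analyticRank = 1) :
    BSDp W p := by
  have hpp : p.Prime := hp.out
  have hp2 : p ≠ 2 := by omega
  subst hN
  haveI : NeZero (NumberField.discr K).natAbs := ⟨Int.natAbs_ne_zero.mpr (NumberField.discr_ne_zero K)⟩
  ---------------------------------------------------------------- the additive prime `p ∣ N_V` splits in `K`
  have hadd : Addv V p := Theorems.PrintCFram.EisensteinResourceBdpLine.addv_of_cmRamified V hCM hram h5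
  have hpN : p ∣ V.conductorNorm ℤ := (V.dvd_conductorNorm_iff_not_hasGoodReductionAtPrime p).mpr hadd.1
  have hHp : SatisfiesHeegnerHypothesis p K := SatisfiesHeegnerHypothesis.of_dvd hpN hHN
  have hsplit : ((Ideal.span {(p : ℤ)}).primesOver (𝓞 K)).ncard = 2 := hHN p hpp hpN
  have hpd : ¬ (p : ℤ) ∣ NumberField.discr K :=
    X11b.Three.not_dvd_discr_of_ncard_primesOver_eq_two hK.1 hp2 hsplit
  have hpd' : ¬ p ∣ (NumberField.discr K).natAbs := fun h ↦ hpd (Int.natCast_dvd.mpr h)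
  ---------------------------------------------------------------- Kriz–Li Thm. 1.20 at `(V, K, ιp)`: the unit logarithm
  have h2 : ∀ ℓ : ℕ, (hℓ : ℓ.Prime) → ¬ (haveI := Fact.mk hℓ; V.HasSplitMultiplicativeReductionAtPrime ℓ) :=
    fun ℓ hℓ hsp ↦ by
      haveI := Fact.mk hℓ
      exact V.not_hasMultiplicativeReductionAtPrime_of_hasCM hCM ℓ hsp.hasMultiplicativeReductionAtPrime
  have hunit := hKL p hp2 V f ψ ω hψ hω hss h1 h1' h2 h3 Dt K hK hHN hsplit εK hεK H ι ιp P hP h4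
  ---------------------------------------------------------------- `P` is non-torsion, hence `r_an(V) = 0`
  have hnt : ¬ IsOfFinAddOrder P :=
    KrizLiLValueFree.not_isOfFinAddOrder_of_padicLogOmega_ne_zero V p ιp (padicLogOmega_ne_zero_of_not_norm_le hunit)
  have hD0 : (NumberField.discr K : ℚ) ≠ 0 := by exact_mod_cast NumberField.discr_ne_zero K
  haveI hEt : (V.quadraticTwist (NumberField.discr K : ℚ)).IsElliptic := V.isElliptic_quadraticTwist hD0
  obtain ⟨C, hC⟩ := hW
  have hCd : C⁻¹ • V.quadraticTwist (NumberField.discr K : ℚ) = W := by rw [← hC, inv_smul_smul]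
  have hLt' : (V.quadraticTwist (NumberField.discr K : ℚ)).entireLFunction = W.entireLFunction := by
    rw [← hCd, entireLFunction_smul]
  have hLt0 : (V.quadraticTwist (NumberField.discr K : ℚ)).entireLFunction 1 = 0 := by
    rw [hLt']; exact entireLFunction_one_eq_zero_of_analyticRank_eq_one hr
  have hprod : LDerivEK V K = V.entireLFunction 1 * deriv W.entireLFunction 1 := by
    rw [AdditivePotMult.lDerivEK_eq_mul_deriv V K hmod hLt0, hLt']
  have hLK : LDerivEK V K ≠ 0 :=
    (lDerivEK_ne_zero_iff_not_isOfFinAddOrder V (V.conductorNorm ℤ) K hGZ hK hHN ⟨Dt, H, ι, hP⟩).mpr hnt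
  have hLV : V.entireLFunction 1 ≠ 0 := fun h0 ↦ hLK (by rw [hprod, h0, zero_mul])
  have hrV : V.analyticRank = 0 := analyticRank_eq_zero_of_entireLFunction_one_ne_zero V hLV
  ---------------------------------------------------------------- `BSD_p(V)` in rank zero (CM: Burungale–Flach)
  have hBV : BSDp V p := bsdp_cm_rankZero hBF hmod hCM hrV
  ---------------------------------------------------------------- (4) splits: unit class factor and unit field factor
  obtain ⟨ha, hb⟩ := BernoulliUnits.norm_bernoulliPair_le_one_of_hss V hCM hram h5 hω ψ hss εK hpd'
  have hne : ¬ ψ.Even := EisensteinPair.not_even_of_odd' ψ hψodd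
  rw [RegularLocusBernoulliPair.bernoulliOnePrim_bernoulliCharOne_of_not_even ψ εK hne] at ha h4
  have hp0 : (0 : ℝ) ≤ (p : ℝ)⁻¹ := by positivity
  have hcls : ¬ ‖bernoulliOnePrim ψ⁻¹‖ ≤ (p : ℝ)⁻¹ := fun h ↦ h4 (by
    rw [norm_mul]
    calc ‖bernoulliOnePrim ψ⁻¹‖ * ‖bernoulliOnePrim (bernoulliCharTwo ψ εK ω)‖
        ≤ (p : ℝ)⁻¹ * 1 := mul_le_mul h hb (norm_nonneg _) hp0
      _ = (p : ℝ)⁻¹ := mul_one _)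
  have hfld : ¬ ‖bernoulliOnePrim (bernoulliCharTwo ψ εK ω)‖ ≤ (p : ℝ)⁻¹ := fun h ↦ h4 (by
    rw [norm_mul]
    calc ‖bernoulliOnePrim ψ⁻¹‖ * ‖bernoulliOnePrim (bernoulliCharTwo ψ εK ω)‖
        ≤ 1 * (p : ℝ)⁻¹ := mul_le_mul ha h (norm_nonneg _) zero_le_one
      _ = (p : ℝ)⁻¹ := one_mul _)
  ---------------------------------------------------------------- `Ш(V)[p] = 0` (rank 0) and `Ш(W)[p] = 0` (rank 1)
  have h0V : ∀ x : V.sha, (p : ℤ) • x = 0 → x = 0 :=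
    ParitySplit.noPTorsion_of_natCard_selmerGroup_le_of_analyticRank_zero V p hCT hGZK hrV
      (LevelDictionaryAlpha.natCard_selmerGroup_le_of_unit_classFactor V p hCM hram h5 ψ ω hψodd hω hss hcls)
  have h0W : ∀ x : W.sha, (p : ℤ) • x = 0 → x = 0 :=
    sha_noPTorsion_twist_of_unit_fieldFactor_of_analyticRank_le_one hCT hGZK V hCM hram h5 ψ ω hψodd hω hss K hK εK
      hεK hfld W ⟨C⁻¹, hCd⟩ hr.le
  ---------------------------------------------------------------- finiteness over `ℚ` (GZK in analytic rank ≤ 1)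
  obtain ⟨-, hfinV⟩ := hGZK V (by rw [hrV]; exact zero_le_one)
  obtain ⟨-, hfinW⟩ := hGZK W hr.le
  haveI : Finite V.sha := hfinV
  haveI : Finite W.sha := hfinW
  ---------------------------------------------------------------- `V(K)[p] = 0` along `ιp`, `p ∤ ∏ c_ℓ(V)`
  have htors : ∀ x : (V.baseChange K).toAffine.Point, p • x = 0 → x = 0 := by
    intro x hx
    have hinj := WeierstrassCurve.Affine.Point.map_injective (W' := V) ιp.toRatAlgHom
    apply hinj
    rw [map_zero]
    exact RamifiedSevenEllipticUnits.prime_nsmul_eq_zero_padic_of_hasCM_of_cmRamified V p hCM h5 hram _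
      (by rw [← map_nsmul, hx, map_zero])
  have htam : ¬ p ∣ V.tamagawaProduct := RouteU.not_dvd_tamagawaProduct_of_hasCM V hCM p hpp h5
  ---------------------------------------------------------------- the `hid` socket: `ord_p #Ш(V/K) = 0` ⟹ the identity
  have hid : Finite (V.baseChange K).sha → X11b.IndexIdentityAt V p K P := fun hfinK => by
    haveI := hfinK
    haveI : (V.baseChange K).IsElliptic := isElliptic_baseChange' V K
    have hcard := card_primaryComponent_sha_baseChange_quadratic_of_odd_of_finite V K hK.1 W ⟨C⁻¹, hCd⟩
      (V.baseChange K) ⟨1, one_smul _ _⟩ p hp2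
    have hsha : padicValNat p (V.baseChange K).shaOrder = padicValNat p V.shaOrder + padicValNat p W.shaOrder := by
      rw [WeierstrassCurve.shaOrder, WeierstrassCurve.shaOrder, WeierstrassCurve.shaOrder,
        ← (Nat.pow_right_injective hpp.two_le).eq_iff, pow_add,
        ← natCard_primaryComponent_eq_pow_padicValNat p, ← natCard_primaryComponent_eq_pow_padicValNat p,
        ← natCard_primaryComponent_eq_pow_padicValNat p]
      exact hcard
    have hsha0 : padicValNat p (V.baseChange K).shaOrder = 0 := by
      rw [hsha, padicValNat_shaOrder_eq_zero_of_noPTorsion V p ‹Finite V.sha› h0V,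
        padicValNat_shaOrder_eq_zero_of_noPTorsion W p ‹Finite W.sha› h0W]
    exact indexIdentityAt_of_not_le_inv_of_addv V p hadd h5 ιp P (c := Dt.maninConstant) hc hunit htors htam hsha0
  ---------------------------------------------------------------- the display and the twist-up brick (w3 g16)
  exact bsdp_twist_of_indexIdentityAt_of_bsdp_rankZero V p (V.conductorNorm ℤ) K Dt H ι P hGZ hKo hGZK hmod hGZ73 hK rfl hHN
    hHp hP h5 hc hrV hBV W ⟨C, hC⟩ hr hid

/-! ## §2. The same in CLASS-DATUM currency: V's co-regularity and the rank-one class's regularity replace (4) -/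

/-- **(GI-S, class-datum currency) `BSD_p` of the rank-one twist from a CO-REGULAR class datum of the base and a REGULAR rank-one class.**
Data as in `bsdp_twist_of_krizLiOddDatum_identityRoad`, except that the Kriz–Li datum of `V` is a CLASS DATUM `(m, χ, ε, k)` in the shape of
`KrizLiBinders.exists_krizLiData_of_cmRamified` — `χ` a primitive quadratic `ℚ_p`-valued character mod `m ⊥ p` with integer values `ε` at the
primes `ℓ ≠ p`, `2 ≤ k ≤ p − 2`, `χ(−1)(−1)^k = −1`, the trace form `a_ℓ(V) ≡ ε(ℓ)(ℓ^k + ℓ^{p−k}) (mod p)` at every prime `ℓ ≠ p`, `V` good at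
every `ℓ ∤ p·m` — and hypothesis (4) is replaced by the TWO Bernoulli numbers of registry v26's currency: the CO-REGULARITY of the base,
`¬ ‖(p−k)⁻¹·B_{p−k,χ}‖_p ≤ p⁻¹` (V's own class factor `B_{1,ψ⁻¹}`, `ψ = χ↑·(ω^k)↑`: `KummerDictionary.norm_bernoulliOnePrim_psi_inv_le_inv_iff`), and
the REGULARITY of the rank-one class, `¬ ‖k⁻¹·B_{k,χε}‖_p ≤ p⁻¹` for any primitive `χε` of level prime to `p` agreeing with `χ·ε_K` off finitely
many primes (the field factor `B_{1,(ψε_Kω⁻¹)~}`: `KummerDictionary.norm_bernoulliOnePrim_bernoulliCharTwo_le_inv_iff`). Conclusion: **`BSDp W p`**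
for every globally minimal `W` with `C • W = V^{(d_K)}` and `ord_{s=1} L(W,s) = 1`. The Kriz–Li binders (primitivity, trace form, (1), (3)) come
from the class datum by w3 g2's engine `KrizLiBinders.krizLiBinders_of_data`; oddness by `KrizLiBinders.psi_odd_of`. At `p = 7`, `V ∼ 49a1^{(f)}`,
`K = ℚ(√D)`, `e* = D·f`: `k = 5`, the pair is `(B_{2,χ_f}/2)·(B_{5,χ_{e*}}/5)` (w8 g9 (c)); `e* = −39 = (−3)·13`: `B_{2,χ₁₃}/2 = 2`.
CONDITIONAL on the named facts; closes no stub. [cite: KrizLi2019, Thm. 1.20 (pp. 7–8), §2 (p. 11), §7.1 (p. 43)]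
[cite: Washington1997, Thm. 5.11 and Cor. 5.13] [cite: Mazur1978, Prop. 6.3 (1) (p. 153)] [cite: GrossZagier1986, Thm. I.(6.3) and I.(7.3)]
[cite: Cassels1962ArithmeticIV] [cite: BurungaleFlach2024, Cor. 2] [cite: Miller2011LMS, Def. 1.1] -/
theorem bsdp_twist_of_classDatum_coregular_identityRoad {p : ℕ} [hp : Fact p.Prime]
    (hKL : thm120_padicLogHeegner_unit_of_bernoulli)
    (hCT : exists_casselsTate_pairing (K := ℚ)) (hGZK : rank_eq_analyticRank_of_analyticRank_le_one)
    (hmod : hasEntireLFunction_rat) (hGZ73 : GrossZagier1986_thm_I_7_3) (hBF : bsdTriple_of_hasCM_of_L_one_ne_zero)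
    (V : WeierstrassCurve ℚ) [V.IsElliptic] [V.IsGloballyMinimal] (hCM : V.HasCM) (hram : CMRamified V p) (h5 : 5 ≤ p)
    {N : ℕ} [NeZero N] (hN : V.conductorNorm ℤ = N)
    (K : Type) [Field K] [NumberField K] (hK : IsImaginaryQuadratic K) (hHN : SatisfiesHeegnerHypothesis N K)
    (hGZ : gross_zagier N V K) (hKo : kolyvagin N V K)
    (Dt : ModularParametrizationData V N) (H : HeegnerDatum N (NumberField.discr K)) (ι : K →+* ℂ) (ιp : K →+* ℚ_[p])
    (P : (V.baseChange K).toAffine.Point)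
    (hP : WeierstrassCurve.Affine.Point.map ι.toRatAlgHom P = heegnerPointComplex Dt H)
    (hc : ¬ (p : ℤ) ∣ Dt.c)
    -- a class datum of `V`
    {m : ℕ} [NeZero m] (χ : DirichletCharacter ℚ_[p] m) (hχ : χ.IsPrimitive) (hχq : χ.IsQuadratic) (hmp : m.Coprime p)
    (ε : ℕ → ℤ) (hε : ∀ ℓ : ℕ, ℓ.Prime → ℓ ≠ p → χ (ℓ : ZMod m) = (ε ℓ : ℚ_[p]))
    {k : ℕ} (hk2 : 2 ≤ k) (hkp : k ≤ p - 2) (hpar : χ (-1) * (-1) ^ k = -1)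
    (htr : ∀ ℓ : ℕ, ℓ.Prime → ℓ ≠ p →
      ((V.LFunction ℓ : ℤ) : ZMod p) = (ε ℓ : ZMod p) * ((ℓ : ZMod p) ^ k + (ℓ : ZMod p) ^ (p - k)))
    (hgood : ∀ ℓ : ℕ, (hℓ : ℓ.Prime) → ℓ ≠ p → ¬ ℓ ∣ m → (haveI := Fact.mk hℓ; V.HasGoodReductionAtPrime ℓ))
    -- CO-REGULARITY of the base: V's own class factor
    (hcoh : ¬ ‖((p - k : ℕ) : ℚ_[p])⁻¹ * generalizedBernoulli (p - k) χ‖ ≤ (p : ℝ)⁻¹)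
    -- the Kronecker character of `K`, and REGULARITY of the rank-one class `(χ·ε_K)~`: the field factor
    (εK : DirichletCharacter ℚ_[p] (NumberField.discr K).natAbs) (hεK : IsKroneckerCharacterOf K εK)
    {c : ℕ} [NeZero c] (hcp : c.Coprime p) (χε : DirichletCharacter ℚ_[p] c) (hχε : χε.IsPrimitive) {N₁ : ℕ} (hN₁ : N₁ ≠ 0)
    (hval : ∀ ℓ : ℕ, ℓ.Prime → ¬ ℓ ∣ N₁ →
      χε (ℓ : ZMod c) = χ (ℓ : ZMod m) * εK (ℓ : ZMod (NumberField.discr K).natAbs))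
    (hreg : ¬ ‖(k : ℚ_[p])⁻¹ * generalizedBernoulli k χε‖ ≤ (p : ℝ)⁻¹)
    -- the rank-one twist
    (W : WeierstrassCurve ℚ) [W.IsElliptic] [W.IsGloballyMinimal]
    (hW : ∃ C : VariableChange ℚ, C • W = V.quadraticTwist (NumberField.discr K : ℚ)) (hr : W.analyticRank = 1) :
    BSDp W p := by
  have hpp : p.Prime := hp.out
  have hp2 : p ≠ 2 := by omega
  haveI : NeZero (p * m) := ⟨Nat.mul_ne_zero hpp.ne_zero (NeZero.ne m)⟩
  haveI : NeZero (NumberField.discr K).natAbs := ⟨Int.natAbs_ne_zero.mpr (NumberField.discr_ne_zero K)⟩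
  obtain ⟨ω, hω⟩ := exists_isTeichmullerCharacter (p := p)
  -- the class character `ψ = χ↑·(ω^k)↑` and its Kriz–Li binders (w3 g2's engine)
  obtain ⟨hprim, hss, ⟨h1, h1'⟩, h3⟩ :=
    KrizLiBinders.krizLiBinders_of_data hp2 V χ hχ hχq hmp ε hε hk2 hkp htr hgood ω hω
  have hψodd := KrizLiBinders.psi_odd_of ω χ k hp2 hω (by omega) hpar
  have hne := EisensteinPair.not_even_of_odd' _ hψodd
  -- the class factor is a unit: co-regularity through the Kummer dictionary
  have hcls : ¬ ‖bernoulliOnePrim (changeLevel (dvd_mul_left m p) χ * changeLevel (dvd_mul_right p m) (ω ^ k) :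
      DirichletCharacter ℚ_[p] (p * m))⁻¹‖ ≤ (p : ℝ)⁻¹ := by
    rw [KummerDictionary.norm_bernoulliOnePrim_psi_inv_le_inv_iff ω χ k hmp hχ hω hk2 hkp, hχq.inv]
    exact hcoh
  -- the field factor is a unit: regularity of the rank-one class through the Kummer dictionary
  have hfld : ¬ ‖bernoulliOnePrim (bernoulliCharTwo (changeLevel (dvd_mul_left m p) χ *
      changeLevel (dvd_mul_right p m) (ω ^ k) : DirichletCharacter ℚ_[p] (p * m)) εK ω)‖ ≤ (p : ℝ)⁻¹ := by
    rw [KummerDictionary.norm_bernoulliOnePrim_bernoulliCharTwo_le_inv_iff ω χ k εK hω hk2 hkp hne hcp χε hχε hN₁ hval]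
    exact hreg
  -- hence Thm. 1.20's hypothesis (4): a `p`-adic number with `¬ ‖a‖ ≤ p⁻¹` has `‖a‖ ≥ 1`
  have h4 : ¬ ‖bernoulliOnePrim (bernoulliCharOne (changeLevel (dvd_mul_left m p) χ *
        changeLevel (dvd_mul_right p m) (ω ^ k) : DirichletCharacter ℚ_[p] (p * m)) εK) *
      bernoulliOnePrim (bernoulliCharTwo (changeLevel (dvd_mul_left m p) χ *
        changeLevel (dvd_mul_right p m) (ω ^ k) : DirichletCharacter ℚ_[p] (p * m)) εK ω)‖ ≤ (p : ℝ)⁻¹ := by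
    rw [RegularLocusBernoulliPair.bernoulliOnePrim_bernoulliCharOne_of_not_even _ εK hne, norm_mul]
    intro hle
    have h1a : (1 : ℝ) ≤ ‖bernoulliOnePrim (changeLevel (dvd_mul_left m p) χ * changeLevel (dvd_mul_right p m) (ω ^ k) :
        DirichletCharacter ℚ_[p] (p * m))⁻¹‖ :=
      not_lt.mp fun hlt => hcls ((Literature.NumberTheory.Automorphic.Brandt.norm_lt_one_iff_le_inv _).mp hlt)
    exact hfld (le_trans (le_mul_of_one_le_left (norm_nonneg _) h1a) hle)
  exact bsdp_twist_of_krizLiOddDatum_identityRoad hKL hCT hGZK hmod hGZ73 hBF V hCM hram h5 hN K hK hHN hGZ hKo Dt H ι ιp P hP hc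
    _ ω hprim hψodd hω hss h1 h1' h3 εK hεK h4 W hW hr

end Summit.BirchSwinnertonDyer.BirchSwinnertonDyer.Theorems.PrintCFram.GenusInternal

end
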